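import Literature.Combinatorics.Optimization.ShellLawWindowLowerBound
import HarnessLib

/-!
# The `a`-FREE window lower bound for a level-`1` shell law:
# `exp(−64(Λ+10)²/(β⁵N))/(128·N²) ≤ law_S(2s+1,1; y₀)` for `|y₀ − s(2a+b)/N| ≤ Λ`, with NO margin on `a`

Cell pnp-psdrank (literature seat g36; eng g23's (C) / eng g22's MEMO-21 §12 scope note). Same object as
`ShellLawWindowLowerBound.shellLaw_one_window_lower` (lit g35, prover g24's (W3)): a fixed-point-free involution
`π`, a `π`-stable ground set `S` of `N` edges with `H`-type `(a,b,d)` (numbers of `HH`, mixed, `H̄H̄` edges), a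
balanced number of full edges `βN ≤ s ≤ (4+β)N/8`, and a reference point `y₀ ∈ ℕ` within `Λ` of `ν = s(2a+b)/N`;
the level-`1` shell law `law_S(2s+1,1;·)` of `|U ∩ H|` is the mixture over the half-vertex `v` and the number `α`
of `HH` edges among the `s` full ones of `C(a_v,α)·δ_{[v∈H]+2α} ∗ Hyp(b_v,d_v; s−α)`.

(W3) needs the three TYPE MARGINS `a, b, d ≥ βN + 1`; its `a`-margin is the only place on the Literature side of
the crossing-plane [BULK] chain where the number of `HH` edges is bounded below (`ShellLawBulkSmoothness` and
`ShellLawRelativeLevelSmoothness.relSmooth_of_hyps` carry `b, d` margins only), and it fails for the `HH`-poor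
matchings of a block (eng MEMO-21 §12: at `|H| = n/2` the margin `a ≥ N/4 + O(D)` fails for about half of all
perfect matchings; for `|H| ≤ √β·n` it fails for almost all). This file removes it:

* **`shellLaw_one_window_lower_afree`** — under `b, d ≥ βN + 1` ONLY (`a ≥ 0` arbitrary), `0 < β ≤ 1/4`,
  `βN ≤ s`, `8s ≤ (4+β)N`, `|y₀ − s(2a+b)/N| ≤ Λ` and the single smallness hypothesis `4Λ + 32 ≤ β³N`:
  `exp(−64(Λ+10)²/(β⁵N))/(128·N²) ≤ law_S(2s+1,1;y₀)`.

Proof (eng g23's one-line design "mode of the `HH` full-edge count × `coeff_hyperGen_window_lower` on the mixed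
edges, margins in units of the window only", made precise). As in (W3) one component `(v, α*)` of the mixture
bounds the law from below (`ShellLawPointwiseMixture.component_le_card_mul_shellLaw`), but the roles of the two
hypergeometric factors are SWAPPED:
(i) the MIXING WEIGHT is taken at an ARGMAX `α*` of the `α`-law `Hyp(a_v, N−1−a_v; s)`: by Chebyshev +
pigeonhole (`PoissonBinomialTilting.exists_max_pmf_ge`, through the Bernoulli-sum representation
`exists_bernoulliProd_eq_hyperGen`) its atom is `≥ 3/(8(2√V_α+1)) ≥ 1/(8√N)` with NO margin hypothesis at all,
and every maximiser is within `2` of the mean `ᾱ = s·a_v/(N−1)` (`hyperGen_argmax_near_mean`)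
— `exists_argmax_coeff_hyperGen_ge`;
(ii) the whole Gaussian price moves to the ATOM `Hyp(b_v,d_v; s−α*)` of the mixed edges, now evaluated
`|y₀ − c(α*)| ≤ Λ + 13/2` off its centre (`centre_dev`: `|y₀ − c(ᾱ)| ≤ Λ + 5/2` as in (W3)'s `centre_numerics`,
plus `θ·|α* − ᾱ| ≤ 4`): `HypergeometricRatioWindow.coeff_hyperGen_window_lower` with window half-width
`L = Λ + 7` and `n₀ = ⌈Λ⌉ + 9`, `(1+η)^{n₀} ≤ e^{n₀η}`, `η ≤ 8(L+1)/V` — `atom_window_lower`;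
(iii) the type margins of that atom law are `a`-FREE (`atom_numerics_afree`): its ground set has
`m = b_v + d_v ≥ 2βN` edges, `b_v, d_v ≥ βN ≥ (β/2)m`, and `|α* − ᾱ| ≤ 2` gives `s−α* ≥ βm − 2 ≥ (β/2)m`,
`m − (s−α*) ≥ m(N−1−s)/(N−1) − 2 ≥ (β/2)m`; so `margins_ge_of_typeMargins` / `ShellLawTypeBounds.hypVar_ge` at
`β/2` give window margins `≥ (β/2)²m ≥ β³N/2 ≥ 2(L+1)` and variance `≥ (β/2)⁴m ≥ β⁵N/8`;
(iv) multiply: `C(N−1,s) ≤ 8√N·C(a_v,α*)C(m,s−α*)`, `C(m,s−α*) ≤ 8√N·e^{E}·Hyp(b_v,d_v;s−α*)_y`,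
`E = 64(Λ+8)(Λ+10)/(β⁵N)`, and `|Shell_S(2s+1,1)| = 2N·C(N−1,s)`: `law(y₀) ≥ e^{−E}/(128N²)`.

All PROVED, 0 sorry, no definitions, no named facts; constants crude and asymptotic only (`4Λ + 32 ≤ β³N` alone
forces `N ≥ 2048`; the variance scale is `β⁵N` because for `HH`-rich ground sets the mixed-edge law lives on
only `≍ 2βN` edges). Intended consumer: the `LB` hypothesis of `relSmooth_of_hyps` (prover g24) WITHOUT the
`a`-margin, towards an `a`-free crossing-plane (CG_1′) (Theorems bricks 124/125 of route `ChebyshevTracialDesign`);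
instrument/support material for the OPEN crux `TracialDecayExp20` — nothing here is a statement about that crux,
about psd rank, or about P vs NP.

## References
* [RollinRoss2010] A. Röllin, N. Ross, *Local limit theorems via Landau–Kolmogorov inequalities*,
  Bernoulli 21 (2015) 851–880, §4.1 Thm 4.2 (the variance scale of hypergeometric smoothness).
* [Rothvoss2017] T. Rothvoß, *The matching polytope has exponential extension complexity*, J. ACM 64
  (2017), §2 (PDF pp. 5–6): cuts, their partition by a perfect matching, the level classes.
* [ChattamvelliShanmugam2020] R. Chattamvelli, R. Shanmugam, *Discrete Distributions in Engineering and the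
  Applied Sciences* (2020), §7.4 Table 7.1 (hypergeometric recurrence, mode, mean, variance).
* [VatutinMikhailov1983] V. A. Vatutin, V. G. Mikhailov, *Limit theorems for the number of empty cells in an
  equiprobable scheme for group allocation of particles*, Theory Probab. Appl. 27 (1983) 734–743, §2.
* [Durrett2019] R. Durrett, *Probability: Theory and Examples*, 5th ed. (2019), Thm. 1.6.4 (Chebyshev).
-/

noncomputable section

open Finset Polynomial

namespace Literature.Combinatorics.Optimization

namespace ShellStep

open Literature.Combinatorics.StablePolynomials (hyperGen coeff_hyperGen coeff_hyperGen_nonneg eval_one_hyperGen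
  natDegree_hyperGen_le coeff_bernoulliProd_eq_pmf exists_bernoulliProd_eq_hyperGen sum_mul_one_sub_eq_of_hyperGen_eq)
open Literature.Probability.Distributions.PoissonBinomial

variable {n : ℕ} {π : Fin n → Fin n}

/-! ### §1 Real-variable lemmas -/

/-- **The centre shift under stripping one edge.** If `(a_Y, b_Y)` is obtained from `(a, b)` by lowering
the type by one edge (`a_Y ≤ a`, `b_Y ≤ b`, `2(a − a_Y) + (b − b_Y) ≤ 2`) with `2a + b ≤ 2N`, then
`|(2a+b)/N − (2a_Y+b_Y)/(N−1)| ≤ 2/(N−1)` (`N > 1`). [folklore] -/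
private theorem abs_centre_shift_le' {N a b aY bY : ℝ} (hN1 : 1 < N) (ha : aY ≤ a) (hb : bY ≤ b)
    (hdrop : 2 * (a - aY) + (b - bY) ≤ 2) (ha0 : 0 ≤ aY) (hb0 : 0 ≤ bY) (hub : 2 * a + b ≤ 2 * N) :
    |(2 * a + b) / N - (2 * aY + bY) / (N - 1)| ≤ 2 / (N - 1) := by
  have hN0 : 0 < N := by linarith
  have hN1' : 0 < N - 1 := by linarith
  have key : (2 * a + b) / N - (2 * aY + bY) / (N - 1) =
      (N * (2 * (a - aY) + (b - bY)) - (2 * a + b)) / (N * (N - 1)) := by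
    field_simp
    ring
  rw [key, abs_div, abs_of_pos (mul_pos hN0 hN1'), div_le_div_iff₀ (mul_pos hN0 hN1') hN1']
  have hδ0 : 0 ≤ 2 * (a - aY) + (b - bY) := by linarith
  have hup : N * (2 * (a - aY) + (b - bY)) - (2 * a + b) ≤ 2 * N := by
    have := mul_le_mul_of_nonneg_left hdrop hN0.le
    nlinarith
  have hlo : -(2 * N) ≤ N * (2 * (a - aY) + (b - bY)) - (2 * a + b) := by
    have := mul_nonneg hN0.le hδ0
    linarith
  have habs : |N * (2 * (a - aY) + (b - bY)) - (2 * a + b)| ≤ 2 * N := abs_le.2 ⟨hlo, hup⟩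
  calc |N * (2 * (a - aY) + (b - bY)) - (2 * a + b)| * (N - 1) ≤ 2 * N * (N - 1) :=
        mul_le_mul_of_nonneg_right habs hN1'.le
    _ = 2 * (N * (N - 1)) := by ring

/-- **Crude upper bound for the hypergeometric variance**: `r b d (m−r)/(m²(m−1)) ≤ m` for `m = b + d ≥ 2`
(any real `r`). [cite: ChattamvelliShanmugam2020, §7.4 Table 7.1 (variance of the hypergeometric law)] -/
private theorem hypVar_le_sum' {b d r : ℝ} (hb : 0 ≤ b) (hd : 0 ≤ d) (h2 : 2 ≤ b + d) :
    r * b * d * (b + d - r) / ((b + d) ^ 2 * (b + d - 1)) ≤ b + d := by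
  have hm0 : 0 < b + d := by linarith
  have hden : 0 < (b + d) ^ 2 * (b + d - 1) := mul_pos (pow_pos hm0 2) (by linarith)
  rw [div_le_iff₀ hden]
  have h1 : r * (b + d - r) ≤ (b + d) ^ 2 / 4 := by nlinarith [sq_nonneg (b + d - 2 * r)]
  have h2' : b * d ≤ (b + d) ^ 2 / 4 := by nlinarith [sq_nonneg (b - d)]
  have h3 : r * b * d * (b + d - r) = (r * (b + d - r)) * (b * d) := by ring
  have h4 : (r * (b + d - r)) * (b * d) ≤ ((b + d) ^ 2 / 4) * ((b + d) ^ 2 / 4) :=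
    mul_le_mul h1 h2' (mul_nonneg hb hd) (by positivity)
  have h5 : ((b + d) ^ 2 / 4) * ((b + d) ^ 2 / 4) ≤ (b + d) * ((b + d) ^ 2 * (b + d - 1)) := by
    have hm3 : 0 ≤ (b + d) ^ 3 := by positivity
    nlinarith
  rw [h3]; exact h4.trans h5

/-- `1/(8√N) ≤ 3/(8(2√V+1))` for `V ≤ N`, `1 ≤ N`. [folklore] -/
private theorem inv_sqrt_le_windowConst' {V N : ℝ} (hV : V ≤ N) (hN : 1 ≤ N) :
    1 / (8 * Real.sqrt N) ≤ 3 / (8 * (2 * Real.sqrt V + 1)) := by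
  have hsN : 1 ≤ Real.sqrt N := by
    rw [show (1 : ℝ) = Real.sqrt 1 by simp]; exact Real.sqrt_le_sqrt hN
  have hsV : Real.sqrt V ≤ Real.sqrt N := Real.sqrt_le_sqrt hV
  have hV0 : 0 ≤ Real.sqrt V := Real.sqrt_nonneg _
  rw [div_le_div_iff₀ (by positivity) (by positivity)]
  nlinarith

/-- `(1 + η)^m ≤ exp(m·η)` for `η ≥ 0`. [folklore] -/
private theorem one_add_pow_le_exp_mul' {η : ℝ} (hη : 0 ≤ η) (m : ℕ) : (1 + η) ^ m ≤ Real.exp (m * η) := by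
  calc (1 + η) ^ m ≤ (Real.exp η) ^ m :=
        pow_le_pow_left₀ (by linarith) (by linarith [Real.add_one_le_exp η]) m
    _ = Real.exp (m * η) := by rw [← Real.exp_nat_mul]

/-! ### §2 The argmax mixing weight, the centre deviation, the `a`-free atom numerics, the atom bound -/

/-- **The mixing weight at an argmax, with no margins.** For the `α`-law `Hyp(a', m; s)` (`s ≤ a' + m`,
`a' + m ≥ 2`) and any `N ≥ max(a'+m, 1)` there is an index `α*` with `|α* − s·a'/(a'+m)| ≤ 2`, `α* ≤ s` and
`C(a'+m, s)/(8√N) ≤ Hyp(a',m;s)_{α*}`: an argmax of the law has atom `≥ 3/(8(2√V+1))` (Chebyshev + pigeonhole on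
the Bernoulli-sum representation, `exists_max_pmf_ge`), `V ≤ a' + m ≤ N`, and maximisers sit within `2` of the
mean (`hyperGen_argmax_near_mean`). [cite: VatutinMikhailov1983, §2] [cite: Durrett2019, Thm. 1.6.4]
[cite: ChattamvelliShanmugam2020, §7.4 Table 7.1 (mode of the hypergeometric law)] -/
theorem exists_argmax_coeff_hyperGen_ge {a' m s : ℕ} {Nr : ℝ} (hs : s ≤ a' + m)
    (h2 : (2 : ℝ) ≤ (a' : ℝ) + m) (hNr : (a' : ℝ) + m ≤ Nr) (hNr1 : 1 ≤ Nr) :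
    ∃ αs : ℕ, |(αs : ℝ) - (s : ℝ) * a' / ((a' : ℝ) + m)| ≤ 2 ∧ αs ≤ s ∧
      (((a' + m).choose s : ℕ) : ℝ) * (1 / (8 * Real.sqrt Nr)) ≤ (hyperGen a' m s).coeff αs := by
  have hN : 0 < a' + m := by
    have : (0 : ℝ) < ((a' + m : ℕ) : ℝ) := by push_cast; linarith only [h2]
    exact_mod_cast this
  obtain ⟨ps, hps0, hlen, hG⟩ := exists_bernoulliProd_eq_hyperGen hs
  have hps : ∀ p ∈ ps, 0 ≤ p ∧ p ≤ 1 := fun p hp => ⟨(hps0 p hp).1.le, (hps0 p hp).2⟩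
  have hVps : (ps.map fun p => p * (1 - p)).sum =
      (s : ℝ) * a' * m * ((a' : ℝ) + m - s) / (((a' : ℝ) + m) ^ 2 * ((a' : ℝ) + m - 1)) :=
    sum_mul_one_sub_eq_of_hyperGen_eq hs hlen hG
  obtain ⟨c, hc⟩ : ∃ e : ℝ, e = (((a' + m).choose s : ℕ) : ℝ) := ⟨_, rfl⟩
  have hc0 : 0 < c := by rw [hc]; exact_mod_cast Nat.choose_pos hs
  have hcoef : ∀ i, (hyperGen a' m s).coeff i = c * pmf ps i := by
    intro i; rw [hG, coeff_C_mul, coeff_bernoulliProd_eq_pmf, hc]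
  obtain ⟨αs, hmax, hmge⟩ := exists_max_pmf_ge ps hps
  rw [hVps] at hmge
  have hmaxH : ∀ i, (hyperGen a' m s).coeff i ≤ (hyperGen a' m s).coeff αs := by
    intro i; rw [hcoef, hcoef]; exact mul_le_mul_of_nonneg_left (hmax i) hc0.le
  have hnear := hyperGen_argmax_near_mean hs hN hmaxH
  -- `V ≤ a' + m ≤ N`, so `3/(8(2√V+1)) ≥ 1/(8√N)`
  have hVN : (s : ℝ) * a' * m * ((a' : ℝ) + m - s) / (((a' : ℝ) + m) ^ 2 * ((a' : ℝ) + m - 1)) ≤ Nr :=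
    (hypVar_le_sum' (Nat.cast_nonneg _) (Nat.cast_nonneg _) h2).trans hNr
  have hwc := inv_sqrt_le_windowConst' hVN hNr1
  have hlow : c * (1 / (8 * Real.sqrt Nr)) ≤ (hyperGen a' m s).coeff αs := by
    rw [hcoef]
    exact mul_le_mul_of_nonneg_left (hwc.trans hmge) hc0.le
  have hαs : αs ≤ s := by
    by_contra h
    have h0 : (hyperGen a' m s).coeff αs = 0 := by rw [coeff_hyperGen, if_neg h]
    have hsq : 0 < Real.sqrt Nr := Real.sqrt_pos.2 (by linarith only [hNr1])
    have : 0 < c * (1 / (8 * Real.sqrt Nr)) := mul_pos hc0 (div_pos one_pos (by positivity))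
    linarith only [this, hlow, h0]
  exact ⟨αs, hnear, hαs, by rw [← hc]; exact hlow⟩

/-- **The centre deviation** (pure real arithmetic). With `m = b_Y + d_Y > 0`, `a_Y + m = N − 1`, the
stripped type one edge below `(a,b,d)`, `2a + b ≤ 2N`, `N ≥ 6`, `0 ≤ s ≤ 5N/8`, `0 ≤ h ≤ 1`,
`|y₀ − s(2a+b)/N| ≤ Λ` and an index `α*` within `2` of the mean `ᾱ = s·a_Y/(N−1)` of the `α`-law: the point
`y₀` is within `Λ + 13/2` of the centre `c(α*) = h + 2α* + (s−α*)·b_Y/m` of the component `(v,α*)` — because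
`c(ᾱ) = h + s(2a_Y+b_Y)/(N−1)` is within `5/2` of `s(2a+b)/N` and `c(α*) − c(ᾱ) = θ(α* − ᾱ)` with
`θ = (b_Y+2d_Y)/m ∈ [0,2]`. [cite: Rothvoss2017, §2 (PDF p. 6)] -/
theorem centre_dev {N a b aY bY dY s h y₀ Λ αs : ℝ} (hN6 : 6 ≤ N) (hm0 : 0 < bY + dY)
    (hbY0 : 0 ≤ bY) (hdY0 : 0 ≤ dY) (haY0 : 0 ≤ aY) (h7 : aY + (bY + dY) = N - 1)
    (haY2 : aY ≤ a) (hbY2 : bY ≤ b) (hdrop : 2 * (a - aY) + (b - bY) ≤ 2) (hub : 2 * a + b ≤ 2 * N)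
    (hs0 : 0 ≤ s) (hs58 : s ≤ 5 * N / 8) (hh0 : 0 ≤ h) (hh1 : h ≤ 1)
    (hy : |y₀ - s * (2 * a + b) / N| ≤ Λ) (hα : |αs - s * aY / (N - 1)| ≤ 2) :
    |y₀ - h - 2 * αs - (s - αs) * bY / (bY + dY)| ≤ Λ + 13 / 2 := by
  have hN1R : 0 < N - 1 := by linarith only [hN6]
  -- the shift of the centre under stripping
  have hshift : |(2 * a + b) / N - (2 * aY + bY) / (N - 1)| ≤ 2 / (N - 1) :=
    abs_centre_shift_le' (by linarith only [hN6]) haY2 hbY2 hdrop haY0 hbY0 hub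
  -- `|y₀ − c(ᾱ)| ≤ Λ + 5/2`
  have hdev : |y₀ - (h + s * (2 * aY + bY) / (N - 1))| ≤ Λ + 5 / 2 := by
    obtain ⟨X2, hX2⟩ : ∃ e : ℝ, e = s * ((2 * a + b) / N - (2 * aY + bY) / (N - 1)) := ⟨_, rfl⟩
    have e2 : |X2| ≤ 3 / 2 := by
      rw [hX2, abs_mul, abs_of_nonneg hs0]
      calc s * |(2 * a + b) / N - (2 * aY + bY) / (N - 1)|
          ≤ (5 * N / 8) * (2 / (N - 1)) := mul_le_mul hs58 hshift (abs_nonneg _) (by linarith only [hs58, hs0])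
        _ ≤ 3 / 2 := by
            rw [show (5 * N / 8) * (2 / (N - 1)) = (5 * N / 4) / (N - 1) by ring, div_le_iff₀ hN1R]
            linarith only [hN6]
    have e1 : y₀ - (h + s * (2 * aY + bY) / (N - 1)) = (y₀ - s * (2 * a + b) / N) + X2 - h := by
      rw [hX2]; ring
    obtain ⟨hy1, hy2⟩ := abs_le.1 hy
    obtain ⟨hx1, hx2⟩ := abs_le.1 e2
    rw [e1, abs_le]; constructor <;> linarith only [hy1, hy2, hx1, hx2, hh0, hh1]
  -- the identity `y₀ − c(α*) = (y₀ − c(ᾱ)) − θ(α* − ᾱ)`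
  have hid : y₀ - h - 2 * αs - (s - αs) * bY / (bY + dY) =
      (y₀ - (h + s * (2 * aY + bY) / (N - 1))) - (bY + 2 * dY) / (bY + dY) * (αs - s * aY / (N - 1)) := by
    rw [show N - 1 = aY + (bY + dY) from h7.symm]
    have hM : aY + (bY + dY) ≠ 0 := by linarith only [haY0, hm0]
    field_simp
    ring
  have hθ2 : (bY + 2 * dY) / (bY + dY) ≤ 2 := by rw [div_le_iff₀ hm0]; linarith only [hbY0]
  have hθ0 : 0 ≤ (bY + 2 * dY) / (bY + dY) := by positivity
  have h4 : |(bY + 2 * dY) / (bY + dY) * (αs - s * aY / (N - 1))| ≤ 4 := by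
    rw [abs_mul, abs_of_nonneg hθ0]
    calc (bY + 2 * dY) / (bY + dY) * |αs - s * aY / (N - 1)| ≤ 2 * 2 :=
          mul_le_mul hθ2 hα (abs_nonneg _) (by norm_num)
      _ = 4 := by norm_num
  obtain ⟨d1, d2⟩ := abs_le.1 hdev
  obtain ⟨e1, e2⟩ := abs_le.1 h4
  rw [hid, abs_le]; constructor <;> linarith only [d1, d2, e1, e2]

/-- **The `a`-free atom numerics** (pure real arithmetic). With `m = b_Y + d_Y`, `a_Y + m = N − 1`, `a_Y ≥ 0`,
`b_Y ≥ b − 1`, `d_Y ≥ d − 1`, the type margins `b, d ≥ βN + 1` (`0 < β ≤ 1/4`), `βN ≤ s`, `8s ≤ (4+β)N`, an index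
`α*` within `2` of `ᾱ = s·a_Y/(N−1)`, `r = s − α*`, and `4Λ + 32 ≤ β³N` (`Λ ≥ 0`): the atom law `Hyp(b_Y,d_Y;r)`
has type margins `b_Y, d_Y, r, m − r ≥ (β/2)·m`, `4 ≤ m ≤ N`, window room `2((Λ+7)+1) ≤ (β/2)²·m`, and variance
floor `β⁵N/8 ≤ (β/2)⁴·m`; also `512 ≤ βN`. (No lower bound on `a` is used: `r ≥ βm − 2` and
`m − r ≥ m(N−1−s)/(N−1) − 2` follow from `|α* − ᾱ| ≤ 2` alone.)
[cite: Rothvoss2017, §2 (PDF p. 6)] [cite: RollinRoss2010, §4.1 Thm 4.2] -/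
theorem atom_numerics_afree {N b d aY bY dY s αs Λ β : ℝ} (hβ : 0 < β) (hβ4 : β ≤ 1 / 4)
    (hbβ : β * N + 1 ≤ b) (hdβ : β * N + 1 ≤ d) (hbY : b - 1 ≤ bY) (hdY : d - 1 ≤ dY)
    (haY0 : 0 ≤ aY) (h7 : aY + (bY + dY) = N - 1)
    (hs : β * N ≤ s) (hs' : 8 * s ≤ (4 + β) * N)
    (hα : |αs - s * aY / (N - 1)| ≤ 2) (hΛ : 4 * Λ + 32 ≤ β ^ 3 * N) (hΛ0 : 0 ≤ Λ) :
    β / 2 * (bY + dY) ≤ bY ∧ β / 2 * (bY + dY) ≤ dY ∧ β / 2 * (bY + dY) ≤ s - αs ∧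
      (s - αs) + β / 2 * (bY + dY) ≤ bY + dY ∧ 4 ≤ bY + dY ∧ bY + dY ≤ N ∧
      2 * ((Λ + 7) + 1) ≤ (β / 2) ^ 2 * (bY + dY) ∧ β ^ 5 * N / 8 ≤ (β / 2) ^ 4 * (bY + dY) ∧
      512 ≤ β * N := by
  -- sizes: `N ≥ 0` (from `8βN ≤ 8s ≤ (4+β)N`), `βN ≥ 512` (from `β³N ≥ 32`, `β ≤ 1/4`), `N ≥ 2048`
  have hβ3N : 32 ≤ β ^ 3 * N := by linarith only [hΛ, hΛ0]
  have hβ2 : β ^ 2 ≤ 1 / 16 := by nlinarith only [hβ, hβ4]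
  have h47 : 0 ≤ 4 * N - 7 * (β * N) := by linarith only [hs, hs']
  have hN0' : 0 ≤ N := by
    by_contra h
    have h' : N < 0 := not_le.1 h
    nlinarith only [h47, h', hβ4]
  have hβNnn : 0 ≤ β * N := mul_nonneg hβ.le hN0'
  have hβN : 512 ≤ β * N := by
    have e : β ^ 3 * N = β ^ 2 * (β * N) := by ring
    have : β ^ 2 * (β * N) ≤ 1 / 16 * (β * N) := mul_le_mul_of_nonneg_right hβ2 hβNnn
    linarith only [hβ3N, e, this]
  have hN0 : 0 < N := by
    have : β * N ≤ 1 / 4 * N := mul_le_mul_of_nonneg_right hβ4 hN0'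
    linarith only [this, hβN]
  have hβ1 : β ≤ 1 := by linarith only [hβ4]
  have hN2048 : 2048 ≤ N := by
    have : β * N ≤ 1 / 4 * N := mul_le_mul_of_nonneg_right hβ4 hN0'
    linarith only [this, hβN]
  have hN1R : 0 < N - 1 := by linarith only [hN2048]
  -- the ground set of the atom law: `2βN ≤ m ≤ N`
  obtain ⟨m, hm⟩ : ∃ e : ℝ, e = bY + dY := ⟨_, rfl⟩
  rw [← hm]
  have hbYβ : β * N ≤ bY := by linarith only [hbβ, hbY]
  have hdYβ : β * N ≤ dY := by linarith only [hdβ, hdY]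
  have hm2β : 2 * (β * N) ≤ m := by rw [hm]; linarith only [hbYβ, hdYβ]
  have hmN : m ≤ N := by
    have : m = N - 1 - aY := by rw [hm]; linarith only [h7]
    rw [this]; linarith only [haY0]
  have hm0 : 0 < m := by linarith only [hm2β, hβN]
  have hm4 : 4 ≤ m := by linarith only [hm2β, hβN]
  have hβm : β * m ≤ β * N := mul_le_mul_of_nonneg_left hmN hβ.le
  have hβm4 : 4 ≤ β * m := by
    have : β * (2 * (β * N)) ≤ β * m := mul_le_mul_of_nonneg_left hm2β hβ.le
    -- `2β²N ≥ 2·β³N/β ...`: use `β²N ≥ β³N` (β ≤ 1)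
    have h2 : β ^ 3 * N ≤ β ^ 2 * N := by
      have := mul_le_mul_of_nonneg_right hβ1 (show 0 ≤ β ^ 2 * N by positivity)
      nlinarith only [this]
    nlinarith only [this, h2, hβ3N]
  -- (1), (2): `b_Y, d_Y ≥ βN ≥ βm ≥ (β/2)m`
  have h1 : β / 2 * m ≤ bY := by nlinarith only [hbYβ, hβm, hβ.le, hm0.le]
  have h2 : β / 2 * m ≤ dY := by nlinarith only [hdYβ, hβm, hβ.le, hm0.le]
  -- the real mean `ᾱ = s·aY/(N−1)` as a product equation
  obtain ⟨q, hq⟩ : ∃ e : ℝ, e = s * aY / (N - 1) := ⟨_, rfl⟩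
  rw [← hq] at hα
  have hqN : q * (N - 1) = s * aY := by rw [hq]; field_simp
  obtain ⟨hα1, hα2⟩ := abs_le.1 hα
  have haYm : aY = N - 1 - m := by rw [hm]; linarith only [h7]
  -- (3): `(N−1)·r ≥ s·m − 2(N−1) ≥ (N−1)(βm − 2) ≥ (N−1)(β/2)m`
  have hs0 : 0 ≤ s := le_trans (by positivity) hs
  have h3 : β / 2 * m ≤ s - αs := by
    -- `(N−1)(s − αs) ≥ (N−1)s − s·aY − 2(N−1) = s·m − 2(N−1)`
    have hprod : s * m - 2 * (N - 1) ≤ (N - 1) * (s - αs) := by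
      have : (N - 1) * αs ≤ s * aY + 2 * (N - 1) := by nlinarith only [hα2, hqN, hN1R.le]
      rw [haYm] at this
      linarith only [this]
    have hsm : β * N * m ≤ s * m := mul_le_mul_of_nonneg_right hs hm0.le
    have hβNm : β * (N - 1) * m ≤ β * N * m := by nlinarith only [hβ.le, hm0.le]
    -- `βm − 2 ≥ (β/2)m` since `βm ≥ 4`
    have hkey : (N - 1) * (β / 2 * m) ≤ (N - 1) * (s - αs) := by nlinarith only [hprod, hsm, hβNm, hβm4, hN1R.le]
    exact le_of_mul_le_mul_left hkey hN1R
  -- (4): `(N−1)(m − r) ≥ m(N−1−s) − 2(N−1) ≥ (N−1)m/4 − 2(N−1) ≥ (N−1)m/8 ≥ (N−1)(β/2)m`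
  have h4 : (s - αs) + β / 2 * m ≤ m := by
    have hprod : (N - 1) * (s - αs) ≤ s * m + 2 * (N - 1) := by
      have : s * aY - 2 * (N - 1) ≤ (N - 1) * αs := by nlinarith only [hα1, hqN, hN1R.le]
      rw [haYm] at this
      linarith only [this]
    -- `s ≤ 17N/32`, so `(7/8)(N−1) − s ≥ (N−1)/4` (`N ≥ 20`)
    have hs17 : s ≤ 17 * N / 32 := by nlinarith only [hs', hβ4, hN0.le]
    have hroom : (N - 1) / 4 ≤ 7 * (N - 1) / 8 - s := by linarith only [hs17, hN2048]
    have hβ8 : β / 2 ≤ 1 / 8 := by linarith only [hβ4]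
    have hkey : (N - 1) * ((s - αs) + β / 2 * m) ≤ (N - 1) * m := by
      have hA : (N - 1) * (β / 2 * m) ≤ (N - 1) * (1 / 8 * m) :=
        mul_le_mul_of_nonneg_left (mul_le_mul_of_nonneg_right hβ8 hm0.le) hN1R.le
      have hB : m * ((N - 1) / 4) ≤ m * (7 * (N - 1) / 8 - s) := mul_le_mul_of_nonneg_left hroom hm0.le
      have hm8 : 8 ≤ m := by linarith only [hm2β, hβN]
      have hC : 8 * (N - 1) ≤ m * (N - 1) := mul_le_mul_of_nonneg_right hm8 hN1R.le
      linarith only [hprod, hA, hB, hC]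
    exact le_of_mul_le_mul_left hkey hN1R
  -- (7): `2(Λ+8) ≤ β³N/2 ≤ (β/2)²·m`
  have h7' : 2 * ((Λ + 7) + 1) ≤ (β / 2) ^ 2 * m := by
    have : β ^ 2 * (2 * (β * N)) ≤ β ^ 2 * m := mul_le_mul_of_nonneg_left hm2β (sq_nonneg β)
    have e : (β / 2) ^ 2 * m = β ^ 2 * m / 4 := by ring
    rw [e]
    have e2 : β ^ 2 * (2 * (β * N)) = 2 * (β ^ 3 * N) := by ring
    linarith only [this, e2, hΛ]
  -- (8): `(β/2)⁴·m ≥ (β/2)⁴·2βN = β⁵N/8`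
  have h8 : β ^ 5 * N / 8 ≤ (β / 2) ^ 4 * m := by
    have : (β / 2) ^ 4 * (2 * (β * N)) ≤ (β / 2) ^ 4 * m := mul_le_mul_of_nonneg_left hm2β (by positivity)
    have e : (β / 2) ^ 4 * (2 * (β * N)) = β ^ 5 * N / 8 := by ring
    linarith only [this, e]
  exact ⟨h1, h2, h3, h4, hm4, hmN, h7', h8, hβN⟩

/-- **The atom bound off-centre.** For `Hyp(b', d'; r)` (`m = b' + d' ≥ 4`) at an index `y` within `L ≥ 2` of the
mean, with the four window margins `≥ 2(L+1)`, a variance floor `0 < V₀ ≤ V`, an exponent `L + 2 ≤ n₀ ≤ L + 3` and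
any `N ≥ max(m, 1)`: `C(m,r)/(8√N) ≤ exp(8(L+1)(L+3)/V₀)·Hyp(b',d';r)_y` — `coeff_hyperGen_window_lower` with
`(1+η)^{n₀} ≤ e^{n₀η}`, `η = 4(m+2)(L+1)/W ≤ 8(L+1)/V₀` (`W = (m−1)V`, `m ≥ 4`), `3/(8(2√V+1)) ≥ 1/(8√N)`.
[cite: ChattamvelliShanmugam2020, §7.4 Table 7.1] [cite: RollinRoss2010, §4.1 Thm 4.2] -/
theorem atom_window_lower {b' d' r y n₀ : ℕ} {L V₀ Nr : ℝ} (hL : 2 ≤ L)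
    (hyw : |(y : ℝ) - (r : ℝ) * b' / ((b' : ℝ) + d')| ≤ L)
    (hn₀ : L + 2 ≤ (n₀ : ℝ)) (hn₀' : (n₀ : ℝ) ≤ L + 3)
    (hbm : 2 * (L + 1) ≤ (b' : ℝ) - (r : ℝ) * b' / ((b' : ℝ) + d'))
    (hrm : 2 * (L + 1) ≤ (r : ℝ) - (r : ℝ) * b' / ((b' : ℝ) + d'))
    (hμm : 2 * (L + 1) ≤ (r : ℝ) * b' / ((b' : ℝ) + d'))
    (hdm : 2 * (L + 1) ≤ (d' : ℝ) - r + (r : ℝ) * b' / ((b' : ℝ) + d'))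
    (hm4 : (4 : ℝ) ≤ (b' : ℝ) + d') (hV₀ : 0 < V₀)
    (hV : V₀ ≤ (r : ℝ) * b' * d' * ((b' : ℝ) + d' - r) / (((b' : ℝ) + d') ^ 2 * ((b' : ℝ) + d' - 1)))
    (hmN : (b' : ℝ) + d' ≤ Nr) (hNr1 : 1 ≤ Nr) :
    (((b' + d').choose r : ℕ) : ℝ) * (1 / (8 * Real.sqrt Nr)) ≤
      Real.exp (8 * (L + 1) * (L + 3) / V₀) * (hyperGen b' d' r).coeff y := by
  have hL0 : 0 ≤ L := by linarith only [hL]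
  have hW := coeff_hyperGen_window_lower (b := b') (d := d') (r := r) (x := y) (n₀ := n₀) (L := L)
    rfl rfl rfl hL hyw (by exact_mod_cast hn₀) hbm hrm hμm hdm
  have hm2 : (2 : ℝ) ≤ (b' : ℝ) + d' := by linarith only [hm4]
  have hm0 : (0 : ℝ) < (b' : ℝ) + d' := by linarith only [hm4]
  -- the variance `V` and `W = (m−1)V`
  obtain ⟨V, hVdef⟩ : ∃ e : ℝ, e = (r : ℝ) * b' * d' * ((b' : ℝ) + d' - r) /
      (((b' : ℝ) + d') ^ 2 * ((b' : ℝ) + d' - 1)) := ⟨_, rfl⟩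
  rw [← hVdef] at hV hW
  have hVpos : 0 < V := lt_of_lt_of_le hV₀ hV
  have hWV : (r : ℝ) * b' * d' * ((b' : ℝ) + d' - r) / ((b' : ℝ) + d') ^ 2 = ((b' : ℝ) + d' - 1) * V := by
    rw [hVdef]
    have h1 : (b' : ℝ) + d' - 1 ≠ 0 := (show (0 : ℝ) < (b' : ℝ) + d' - 1 by linarith only [hm2]).ne'
    have h2 : (b' : ℝ) + d' ≠ 0 := hm0.ne'
    field_simp
  have hW0 : 0 < (r : ℝ) * b' * d' * ((b' : ℝ) + d' - r) / ((b' : ℝ) + d') ^ 2 := by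
    rw [hWV]; exact mul_pos (by linarith only [hm2]) hVpos
  -- `η ≤ 8(L+1)/V₀`
  have hη : 4 * ((b' : ℝ) + d' + 2) * (L + 1) /
      ((r : ℝ) * b' * d' * ((b' : ℝ) + d' - r) / ((b' : ℝ) + d') ^ 2) ≤ 8 * (L + 1) / V₀ := by
    rw [hWV, div_le_div_iff₀ (mul_pos (by linarith only [hm2]) hVpos) hV₀]
    have h48 : 4 * ((b' : ℝ) + d' + 2) ≤ 8 * ((b' : ℝ) + d' - 1) := by linarith only [hm4]
    have hK0 : 0 ≤ (L + 1) * V₀ := mul_nonneg (by linarith only [hL0]) hV₀.le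
    calc 4 * ((b' : ℝ) + d' + 2) * (L + 1) * V₀ = 4 * ((b' : ℝ) + d' + 2) * ((L + 1) * V₀) := by ring
      _ ≤ 8 * ((b' : ℝ) + d' - 1) * ((L + 1) * V₀) := mul_le_mul_of_nonneg_right h48 hK0
      _ = 8 * (L + 1) * (((b' : ℝ) + d' - 1) * V₀) := by ring
      _ ≤ 8 * (L + 1) * (((b' : ℝ) + d' - 1) * V) :=
          mul_le_mul_of_nonneg_left (mul_le_mul_of_nonneg_left hV (by linarith only [hm2]))
            (by linarith only [hL0])
  have hη0 : 0 ≤ 4 * ((b' : ℝ) + d' + 2) * (L + 1) /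
      ((r : ℝ) * b' * d' * ((b' : ℝ) + d' - r) / ((b' : ℝ) + d') ^ 2) :=
    div_nonneg (mul_nonneg (by positivity) (by linarith only [hL0])) hW0.le
  -- `(1+η)^{n₀} ≤ e^{8(L+1)(L+3)/V₀}`
  have hpow : (1 + 4 * ((b' : ℝ) + d' + 2) * (L + 1) /
      ((r : ℝ) * b' * d' * ((b' : ℝ) + d' - r) / ((b' : ℝ) + d') ^ 2)) ^ n₀ ≤
      Real.exp (8 * (L + 1) * (L + 3) / V₀) := by
    refine (one_add_pow_le_exp_mul' hη0 n₀).trans (Real.exp_le_exp.2 ?_)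
    have h1 : (n₀ : ℝ) * (4 * ((b' : ℝ) + d' + 2) * (L + 1) /
        ((r : ℝ) * b' * d' * ((b' : ℝ) + d' - r) / ((b' : ℝ) + d') ^ 2)) ≤ (L + 3) * (8 * (L + 1) / V₀) :=
      mul_le_mul hn₀' hη hη0 (by linarith only [hL0])
    have e : (L + 3) * (8 * (L + 1) / V₀) = 8 * (L + 1) * (L + 3) / V₀ := by ring
    linarith only [h1, e]
  -- `V ≤ N`, so `3/(8(2√V+1)) ≥ 1/(8√N)`
  have hVN : V ≤ Nr := by
    rw [hVdef]; exact (hypVar_le_sum' (Nat.cast_nonneg _) (Nat.cast_nonneg _) hm2).trans hmN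
  have hc := inv_sqrt_le_windowConst' hVN hNr1
  calc _ ≤ (((b' + d').choose r : ℕ) : ℝ) * (3 / (8 * (2 * Real.sqrt V + 1))) :=
        mul_le_mul_of_nonneg_left hc (Nat.cast_nonneg _)
    _ ≤ _ := hW
    _ ≤ _ := mul_le_mul_of_nonneg_right hpow (coeff_hyperGen_nonneg _ _ _ _)

/-! ### §3 The `a`-free window lower bound -/

section Main

variable (hπ : ∀ v, π (π v) = v) (hπ' : ∀ v, π v ≠ v)
include hπ hπ'

/-- **THE `a`-FREE WINDOW LOWER BOUND FOR A LEVEL-`1` SHELL LAW.** Let `π` be a fixed-point-free involution,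
`S` a `π`-stable ground set of `H`-type `(a,b,d)`, `a + b + d = N`, with type margins `b, d ≥ βN + 1` ONLY
(`0 < β ≤ 1/4`; no hypothesis on the number `a` of `HH` edges), `βN ≤ s`, `8s ≤ (4+β)N`, and `y₀ ∈ ℕ` with
`|y₀ − s(2a+b)/N| ≤ Λ`. If `4Λ + 32 ≤ β³N`, then `exp(−64(Λ+10)²/(β⁵N))/(128·N²) ≤ law_S(2s+1,1;y₀)`.
(One vertex `v`; the component `(v, α*)` with `α*` an ARGMAX of the `α`-law (`exists_argmax_coeff_hyperGen_ge`:
mixing weight `≥ C(N−1,s)/(8√N)`, `|α* − ᾱ| ≤ 2`); the atom `Hyp(b_v,d_v;s−α*)` at distance `≤ Λ + 13/2` from its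
centre (`centre_dev`) through `atom_window_lower` on the `a`-free margins of `atom_numerics_afree`
(`margins_ge_of_typeMargins`, `hypVar_ge` at `β/2`); `component_le_card_mul_shellLaw` and
`|Shell_S(2s+1,1)| = 2N·C(N−1,s)`.)
[cite: RollinRoss2010, §4.1 Thm 4.2] [cite: Rothvoss2017, §2 (PDF p. 6)]
[cite: ChattamvelliShanmugam2020, §7.4 Table 7.1] [cite: VatutinMikhailov1983, §2] -/
theorem shellLaw_one_window_lower_afree {S : Finset (Fin n)} (hS : ∀ v ∈ S, π v ∈ S) (H : Finset (Fin n))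
    {a b d N : ℕ} (ha : (reps π (vAA π S H)).card = a) (hb : (reps π (vBH π S H ∪ vBN π S H)).card = b)
    (hd : (reps π (vDD π S H)).card = d) (hN : a + b + d = N)
    {β : ℝ} (hβ : 0 < β) (hβ4 : β ≤ 1 / 4)
    (hbβ : β * N + 1 ≤ b) (hdβ : β * N + 1 ≤ d)
    {s : ℕ} (hs : β * N ≤ s) (hs' : 8 * (s : ℝ) ≤ (4 + β) * N)
    {y₀ : ℕ} {Λ : ℝ} (hy : |(y₀ : ℝ) - s * (2 * a + b) / N| ≤ Λ)
    (hΛ : 4 * Λ + 32 ≤ β ^ 3 * N) :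
    Real.exp (-(64 * (Λ + 10) ^ 2 / (β ^ 5 * (N : ℝ)))) / (128 * (N : ℝ) ^ 2) ≤
      shellLaw π S H (1 + 2 * s) 1 y₀ := by
  classical
  /- ───── 0. basic real bookkeeping ───── -/
  have hβ1 : β ≤ 1 := by linarith only [hβ4]
  have hΛ0 : 0 ≤ Λ := (abs_nonneg _).trans hy
  have hNsum : (a : ℝ) + b + d = N := by exact_mod_cast hN
  have hβN0 : β * (N : ℝ) ≤ N := by
    have := mul_le_mul_of_nonneg_right hβ1 (Nat.cast_nonneg N); linarith only [this]
  -- `|S| = 2N`, hence `S` is nonempty (from `b ≥ 1`)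
  have hcardS : S.card = 2 * N := by
    have := two_mul_typeReps_eq_card hπ hπ' hS H
    rw [ha, hb, hd] at this; omega
  have hb1 : 1 ≤ b := by
    have : (1 : ℝ) ≤ b := by linarith only [hbβ, mul_nonneg hβ.le (Nat.cast_nonneg N)]
    exact_mod_cast this
  have hN1 : 1 ≤ N := by omega
  obtain ⟨v, hv⟩ : S.Nonempty := card_pos.1 (by omega)
  /- ───── 1. the half-set `{v}` and the stripped types ───── -/
  have hY : ({v} : Finset (Fin n)) ∈ halfSets π S 1 := by
    rw [halfSets_one_eq_image hπ' S]; exact mem_image_of_mem _ hv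
  obtain ⟨h1, h2, h3, h4, h5, h6, h7⟩ := strip_one_types hπ hπ' hS H hY
  rw [ha] at h1 h2
  rw [hb] at h3 h4
  rw [hd] at h5 h6
  rw [ha, hb, hd] at h7
  obtain ⟨aY, haY⟩ : ∃ e, (reps π (vAA π (strip π S {v}) H)).card = e := ⟨_, rfl⟩
  obtain ⟨bY, hbY⟩ : ∃ e, (reps π (vBH π (strip π S {v}) H ∪ vBN π (strip π S {v}) H)).card = e := ⟨_, rfl⟩
  obtain ⟨dY, hdY⟩ : ∃ e, (reps π (vDD π (strip π S {v}) H)).card = e := ⟨_, rfl⟩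
  rw [haY] at h1 h2 h7
  rw [hbY] at h3 h4 h7
  rw [hdY] at h5 h6 h7
  obtain ⟨hv0, hσ⟩ : ∃ e, (({v} : Finset (Fin n)) ∩ H).card = e := ⟨_, rfl⟩
  have hh1 : hv0 ≤ 1 := by
    rw [← hσ]; exact (card_le_card inter_subset_left).trans (card_singleton v).le
  obtain ⟨mY, hmY⟩ : ∃ e : ℕ, e = bY + dY := ⟨_, rfl⟩
  -- real casts of the type data
  have h7R : (aY : ℝ) + mY = (N : ℝ) - 1 := by
    have : ((aY + (bY + dY) + 1 : ℕ) : ℝ) = ((a + (b + d) : ℕ) : ℝ) := by rw [h7]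
    push_cast at this
    rw [hmY]; push_cast; linarith only [this, hNsum]
  have hmYR : (mY : ℝ) = (bY : ℝ) + dY := by rw [hmY]; push_cast; ring
  have h7R' : (aY : ℝ) + ((bY : ℝ) + dY) = (N : ℝ) - 1 := by rw [← hmYR]; exact h7R
  have haY2 : (aY : ℝ) ≤ a := by exact_mod_cast h2
  have hbY1 : (b : ℝ) - 1 ≤ bY := by
    have : (b : ℝ) ≤ bY + 1 := by exact_mod_cast h3
    linarith only [this]
  have hbY2 : (bY : ℝ) ≤ b := by exact_mod_cast h4
  have hdY1 : (d : ℝ) - 1 ≤ dY := by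
    have : (d : ℝ) ≤ dY + 1 := by exact_mod_cast h5
    linarith only [this]
  have hdrop : 2 * ((a : ℝ) - aY) + ((b : ℝ) - bY) ≤ 2 := by
    have : 2 * (a - aY) + (b - bY) ≤ 2 := by omega
    have h' : ((2 * (a - aY) + (b - bY) : ℕ) : ℝ) ≤ 2 := by exact_mod_cast this
    push_cast [Nat.cast_sub h2, Nat.cast_sub h4] at h'
    linarith only [h']
  /- ───── 2. the argmax index `α*` of the `α`-law and the `a`-free atom numerics ───── -/
  -- first the numerics at the (yet unknown) index: we need `N ≥ 2048` etc. to place `α*`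
  have hpre := atom_numerics_afree (N := (N : ℝ)) (b := b) (d := d) (aY := aY) (bY := bY) (dY := dY) (s := s)
    (αs := (s : ℝ) * aY / ((N : ℝ) - 1)) (Λ := Λ) hβ hβ4 hbβ hdβ hbY1 hdY1 (Nat.cast_nonneg _) h7R' hs hs'
    (by rw [sub_self, abs_zero]; norm_num) hΛ hΛ0
  obtain ⟨-, -, -, -, hm4, hmN, -, -, hβN⟩ := hpre
  have hN2048 : (2048 : ℝ) ≤ N := by
    have : β * (N : ℝ) ≤ 1 / 4 * N := mul_le_mul_of_nonneg_right hβ4 (Nat.cast_nonneg N)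
    linarith only [this, hβN]
  have hNR0 : (0 : ℝ) < N := by linarith only [hN2048]
  have hN1R : (0 : ℝ) < (N : ℝ) - 1 := by linarith only [hN2048]
  have hm0 : (0 : ℝ) < (bY : ℝ) + dY := by linarith only [hm4]
  have hN'2 : (2 : ℝ) ≤ (aY : ℝ) + mY := by linarith only [h7R, hN2048]
  have hs58 : (s : ℝ) ≤ 5 * N / 8 := by linarith only [hs', hβN0]
  have hsle : s ≤ aY + mY := by
    have : (s : ℝ) ≤ (aY : ℝ) + mY := by rw [h7R]; linarith only [hs58, hN2048]
    exact_mod_cast this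
  -- the argmax
  obtain ⟨αs, hαnear, hαss, hA⟩ := exists_argmax_coeff_hyperGen_ge (a' := aY) (m := mY) (s := s)
    (Nr := (N : ℝ)) hsle hN'2 (by linarith only [h7R]) (by linarith only [hN2048])
  rw [h7R] at hαnear
  rw [coeff_hyperGen, if_pos hαss] at hA
  -- the numerics at `α*`
  obtain ⟨hMb, hMd, hMr, hMr', -, -, hroom, hVfloor, -⟩ := atom_numerics_afree (N := (N : ℝ)) (b := b)
    (d := d) (aY := aY) (bY := bY) (dY := dY) (s := s) (αs := (αs : ℝ)) (Λ := Λ) hβ hβ4 hbβ hdβ hbY1 hdY1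
    (Nat.cast_nonneg _) h7R' hs hs' hαnear hΛ hΛ0
  /- ───── 3. the atom: the component `({v}, α*)` at distance `≤ Λ + 13/2` from `y₀` ───── -/
  obtain ⟨r, hr⟩ : ∃ e : ℕ, e = s - αs := ⟨_, rfl⟩
  have hrR : (r : ℝ) = s - αs := by rw [hr]; push_cast [Nat.cast_sub hαss]; ring
  have hgood : |(y₀ : ℝ) - hv0 - 2 * (αs : ℝ) - ((s : ℝ) - αs) * bY / ((bY : ℝ) + dY)| ≤ Λ + 13 / 2 :=
    centre_dev (N := (N : ℝ)) (a := a) (b := b) (aY := aY) (bY := bY) (dY := dY) (s := s) (h := hv0)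
      (y₀ := y₀) (Λ := Λ) (αs := αs) (by linarith only [hN2048]) hm0 (Nat.cast_nonneg _) (Nat.cast_nonneg _)
      (Nat.cast_nonneg _) h7R' haY2 hbY2 hdrop
      (by linarith only [hNsum, (Nat.cast_nonneg d : (0 : ℝ) ≤ d)]) (Nat.cast_nonneg _) hs58
      (Nat.cast_nonneg _) (by exact_mod_cast hh1) hy hαnear
  -- type margins of the atom law `Hyp(bY, dY; r)` at `β/2`, window margins, variance floor
  have hβ2 : 0 < β / 2 := by positivity
  rw [← hrR] at hMr hMr'
  obtain ⟨hM1, hM2, hM3, hM4⟩ := margins_ge_of_typeMargins (b := bY) (d := dY) (r := r) (β := β / 2)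
    (μ := (r : ℝ) * bY / ((bY : ℝ) + dY)) hβ2 hMb hMd hMr hMr' rfl
  have hVge := hypVar_ge (b := (bY : ℝ)) (d := (dY : ℝ)) (r := (r : ℝ)) hβ2 (by linarith only [hm4])
    hMb hMd hMr hMr'
  have hV₀ : 0 < β ^ 5 * (N : ℝ) / 8 := by positivity
  -- the local index `y = y₀ − hv0 − 2α*` and its distance to the atom's mean
  have hμ16 : 2 * ((Λ + 7) + 1) ≤ (r : ℝ) * bY / ((bY : ℝ) + dY) := hroom.trans hM3
  have hσle : hv0 + 2 * αs ≤ y₀ := by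
    obtain ⟨hg1, -⟩ := abs_le.1 hgood
    have : ((hv0 + 2 * αs : ℕ) : ℝ) ≤ (y₀ : ℝ) := by
      push_cast
      have e : ((s : ℝ) - αs) * bY / ((bY : ℝ) + dY) = (r : ℝ) * bY / ((bY : ℝ) + dY) := by rw [hrR]
      linarith only [hg1, hμ16, e, hΛ0]
    exact_mod_cast this
  obtain ⟨y, hyy⟩ : ∃ y : ℕ, y₀ = hv0 + 2 * αs + y := ⟨y₀ - (hv0 + 2 * αs), by omega⟩
  have hyR : (y : ℝ) = (y₀ : ℝ) - hv0 - 2 * αs := by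
    have : (y₀ : ℝ) = ((hv0 + 2 * αs + y : ℕ) : ℝ) := by rw [← hyy]
    push_cast at this; linarith only [this]
  have hyw : |(y : ℝ) - (r : ℝ) * bY / ((bY : ℝ) + dY)| ≤ Λ + 7 := by
    have e : (y : ℝ) - (r : ℝ) * bY / ((bY : ℝ) + dY) =
        (y₀ : ℝ) - hv0 - 2 * (αs : ℝ) - ((s : ℝ) - αs) * bY / ((bY : ℝ) + dY) := by rw [hyR, hrR]
    rw [e]; exact hgood.trans (by linarith only [hΛ0])
  -- the exponent `n₀ = ⌈Λ⌉ + 9`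
  obtain ⟨n₀, hn₀⟩ : ∃ e : ℕ, e = ⌈Λ⌉₊ + 9 := ⟨_, rfl⟩
  have hn₀ge : (Λ + 7) + 2 ≤ (n₀ : ℝ) := by
    rw [hn₀]; push_cast; linarith only [Nat.le_ceil Λ]
  have hn₀le : (n₀ : ℝ) ≤ (Λ + 7) + 3 := by
    rw [hn₀]; push_cast; linarith only [Nat.ceil_lt_add_one hΛ0]
  have hB := atom_window_lower (b' := bY) (d' := dY) (r := r) (y := y) (n₀ := n₀) (L := Λ + 7)
    (V₀ := β ^ 5 * (N : ℝ) / 8) (Nr := (N : ℝ)) (by linarith only [hΛ0]) hyw hn₀ge hn₀le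
    (hroom.trans hM1) (hroom.trans hM2) hμ16 (hroom.trans hM4) hm4 hV₀ (hVfloor.trans hVge) hmN
    (by linarith only [hN2048])
  rw [← hmY] at hB
  /- ───── 4. one component bounds the law from below; bookkeeping ───── -/
  have hcomp := component_le_card_mul_shellLaw hπ hπ' hS H 1 s hY hαss (y₀ := y₀) (by rw [hσ]; exact hσle)
  rw [haY, hbY, hdY, hσ, ← hr, show y₀ - (hv0 + 2 * αs) = y by omega] at hcomp
  have hcard : ((shellIn π S (1 + 2 * s) 1).card : ℝ) = 2 * N * (((aY + mY).choose s : ℕ) : ℝ) := by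
    rw [card_shellIn_one hπ hπ' S hS s, hcardS, show 2 * N / 2 - 1 = aY + mY by omega]
    push_cast; ring
  rw [hcard] at hcomp
  have hCα0 : (0 : ℝ) < (((aY + mY).choose s : ℕ) : ℝ) := by exact_mod_cast Nat.choose_pos hsle
  have hsqN : Real.sqrt N * Real.sqrt N = N := Real.mul_self_sqrt hNR0.le
  -- the exponent of the atom bound is at most `64(Λ+10)²/(β⁵N)`
  obtain ⟨E, hE⟩ : ∃ e : ℝ, e = 64 * (Λ + 10) ^ 2 / (β ^ 5 * (N : ℝ)) := ⟨_, rfl⟩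
  have hEle : Real.exp (8 * ((Λ + 7) + 1) * ((Λ + 7) + 3) / (β ^ 5 * (N : ℝ) / 8)) ≤ Real.exp E := by
    rw [hE, Real.exp_le_exp]
    have hD0 : 0 < β ^ 5 * (N : ℝ) := by positivity
    rw [show 8 * ((Λ + 7) + 1) * ((Λ + 7) + 3) / (β ^ 5 * (N : ℝ) / 8) =
        64 * ((Λ + 8) * (Λ + 10)) / (β ^ 5 * (N : ℝ)) by field_simp; ring]
    rw [div_le_div_iff_of_pos_right hD0]
    nlinarith only [hΛ0]
  have hexpE : 0 < Real.exp E := Real.exp_pos _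
  have hCY0 : (0 : ℝ) ≤ ((aY.choose αs : ℕ) : ℝ) := Nat.cast_nonneg _
  have h8 : (0 : ℝ) < 8 * Real.sqrt N := by
    have : 0 < Real.sqrt (N : ℝ) := Real.sqrt_pos.2 hNR0
    positivity
  have hA' : (((aY + mY).choose s : ℕ) : ℝ) ≤
      8 * Real.sqrt N * (((aY.choose αs : ℕ) : ℝ) * ((mY.choose r : ℕ) : ℝ)) := by
    have e : ((aY.choose αs * mY.choose (s - αs) : ℕ) : ℝ) =
        ((aY.choose αs : ℕ) : ℝ) * ((mY.choose r : ℕ) : ℝ) := by rw [← hr]; push_cast; ring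
    rw [e] at hA
    have h := mul_le_mul_of_nonneg_right hA h8.le
    have e2 : (((aY + mY).choose s : ℕ) : ℝ) * (1 / (8 * Real.sqrt N)) * (8 * Real.sqrt N) =
        (((aY + mY).choose s : ℕ) : ℝ) := by field_simp
    rw [e2] at h
    linarith only [h]
  have hB' : ((mY.choose r : ℕ) : ℝ) ≤ 8 * Real.sqrt N * Real.exp E * (hyperGen bY dY r).coeff y := by
    have h := mul_le_mul_of_nonneg_right hB h8.le
    have e2 : ((mY.choose r : ℕ) : ℝ) * (1 / (8 * Real.sqrt N)) * (8 * Real.sqrt N) =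
        ((mY.choose r : ℕ) : ℝ) := by field_simp
    rw [e2] at h
    have hco : 0 ≤ (hyperGen bY dY r).coeff y := coeff_hyperGen_nonneg _ _ _ _
    have h' : Real.exp (8 * ((Λ + 7) + 1) * ((Λ + 7) + 3) / (β ^ 5 * (N : ℝ) / 8)) *
        (hyperGen bY dY r).coeff y * (8 * Real.sqrt N) ≤
        Real.exp E * (hyperGen bY dY r).coeff y * (8 * Real.sqrt N) :=
      mul_le_mul_of_nonneg_right (mul_le_mul_of_nonneg_right hEle hco) h8.le
    linarith only [h, h']
  have hchain : (((aY + mY).choose s : ℕ) : ℝ) ≤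
      128 * (N : ℝ) ^ 2 * Real.exp E * shellLaw π S H (1 + 2 * s) 1 y₀ * (((aY + mY).choose s : ℕ) : ℝ) :=
    calc (((aY + mY).choose s : ℕ) : ℝ)
        ≤ 8 * Real.sqrt N * (((aY.choose αs : ℕ) : ℝ) * ((mY.choose r : ℕ) : ℝ)) := hA'
      _ ≤ 8 * Real.sqrt N *
            (((aY.choose αs : ℕ) : ℝ) * (8 * Real.sqrt N * Real.exp E * (hyperGen bY dY r).coeff y)) :=
          mul_le_mul_of_nonneg_left (mul_le_mul_of_nonneg_left hB' hCY0) h8.le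
      _ = 64 * (Real.sqrt N * Real.sqrt N) * Real.exp E *
            (((aY.choose αs : ℕ) : ℝ) * (hyperGen bY dY r).coeff y) := by ring
      _ ≤ 64 * (Real.sqrt N * Real.sqrt N) * Real.exp E *
            (2 * N * (((aY + mY).choose s : ℕ) : ℝ) * shellLaw π S H (1 + 2 * s) 1 y₀) :=
          mul_le_mul_of_nonneg_left hcomp (by positivity)
      _ = _ := by rw [hsqN]; ring
  have hone : 1 ≤ 128 * (N : ℝ) ^ 2 * Real.exp E * shellLaw π S H (1 + 2 * s) 1 y₀ :=
    le_of_mul_le_mul_right (by rw [one_mul]; exact hchain) hCα0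
  -- conclude
  rw [show -(64 * (Λ + 10) ^ 2 / (β ^ 5 * (N : ℝ))) = -E by rw [hE], Real.exp_neg,
    div_le_iff₀ (by positivity)]
  calc (Real.exp E)⁻¹ = (Real.exp E)⁻¹ * 1 := by ring
    _ ≤ (Real.exp E)⁻¹ * (128 * (N : ℝ) ^ 2 * Real.exp E * shellLaw π S H (1 + 2 * s) 1 y₀) :=
        mul_le_mul_of_nonneg_left hone (inv_nonneg.2 hexpE.le)
    _ = shellLaw π S H (1 + 2 * s) 1 y₀ * (128 * (N : ℝ) ^ 2) := by
        field_simp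

/-! ### §4 (v2) The same in the cell's window currency (turnkey `hLB`) -/

/-- **THE `a`-FREE WINDOW LOWER BOUND IN THE CELL'S WINDOW CURRENCY** (turnkey form of
`shellLaw_one_window_lower_afree` for the Summits-side assembly): with the cut written `2s+1`, the point `x : ℕ` in
the block-statistic window `|x − (2s+1)(2a+b)/(2N)| ≤ ε` (the cell's window; its centre differs from `s(2a+b)/N` by
`(2a+b)/(2N) ≤ 1`, so `Λ = ε + 1`) and the single smallness condition `4ε + 36 ≤ β³N`:
`exp(−64(ε+11)²/(β⁵N))/(128·N²) ≤ law_S(2s+1,1;x)`. Same hypothesis pack as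
`ShellLawLineSection.centredSq_law_ge_of_typeMargins'` minus the `HH` margin: `0 < β ≤ 1/4`, `βN + 1 ≤ b, d`,
`βN ≤ s`, `8s ≤ (4+β)N`. The floor does not depend on `x`, so it serves as ONE `LB` for every point of a window set.
[cite: RollinRoss2010, §4.1 Thm 4.2] [cite: Rothvoss2017, §2 (PDF p. 6)] [cite: ChattamvelliShanmugam2020, §7.4 Table 7.1] -/
theorem shellLaw_one_window_lower_afree_cell {S : Finset (Fin n)} (hS : ∀ v ∈ S, π v ∈ S) (H : Finset (Fin n))
    {a b d N : ℕ} (ha : (reps π (vAA π S H)).card = a) (hb : (reps π (vBH π S H ∪ vBN π S H)).card = b)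
    (hd : (reps π (vDD π S H)).card = d) (hN : a + b + d = N)
    {β : ℝ} (hβ : 0 < β) (hβ4 : β ≤ 1 / 4)
    (hbβ : β * N + 1 ≤ b) (hdβ : β * N + 1 ≤ d)
    {s : ℕ} (hs : β * N ≤ s) (hs' : 8 * (s : ℝ) ≤ (4 + β) * N)
    {x : ℕ} {ε : ℝ} (hx : |(x : ℝ) - (2 * s + 1) * (2 * a + b) / (2 * (N : ℝ))| ≤ ε)
    (hε : 4 * ε + 36 ≤ β ^ 3 * N) :
    Real.exp (-(64 * (ε + 11) ^ 2 / (β ^ 5 * (N : ℝ)))) / (128 * (N : ℝ) ^ 2) ≤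
      shellLaw π S H (2 * s + 1) 1 x := by
  -- `N > 0` from `b ≥ βN + 1 ≥ 1` and `a + b + d = N`
  have hb1 : 1 ≤ b := by
    have : (1 : ℝ) ≤ b := by linarith only [hbβ, mul_nonneg hβ.le (Nat.cast_nonneg N)]
    exact_mod_cast this
  have hN1 : 1 ≤ N := by omega
  have hNpos : (0 : ℝ) < N := by exact_mod_cast hN1
  have hNsum : (a : ℝ) + b + d = N := by exact_mod_cast hN
  -- the cell's window centre is within `1` of `s(2a+b)/N`
  have hP0 : (0 : ℝ) ≤ 2 * a + b := by positivity
  have hPN : 2 * (a : ℝ) + b ≤ 2 * N := by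
    have : (0 : ℝ) ≤ d := Nat.cast_nonneg d
    linarith only [hNsum, this, Nat.cast_nonneg (α := ℝ) a]
  have hshift : |(2 * (s : ℝ) + 1) * (2 * a + b) / (2 * (N : ℝ)) - s * (2 * a + b) / N| ≤ 1 := by
    have e : (2 * (s : ℝ) + 1) * (2 * a + b) / (2 * (N : ℝ)) - s * (2 * a + b) / N = (2 * a + b) / (2 * N) := by
      field_simp; ring
    rw [e, abs_of_nonneg (by positivity), div_le_one (by positivity)]
    exact hPN
  have hy : |(x : ℝ) - s * (2 * a + b) / N| ≤ ε + 1 := by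
    have t := abs_sub_le ((x : ℝ)) ((2 * (s : ℝ) + 1) * (2 * a + b) / (2 * (N : ℝ))) ((s : ℝ) * (2 * a + b) / N)
    linarith only [t, hx, hshift]
  have hΛ : 4 * (ε + 1) + 32 ≤ β ^ 3 * N := by linarith only [hε]
  have key := shellLaw_one_window_lower_afree hπ hπ' hS H ha hb hd hN hβ hβ4 hbβ hdβ hs hs' hy hΛ
  have e11 : (ε + 1 + 10 : ℝ) = ε + 11 := by ring
  rw [e11, show 1 + 2 * s = 2 * s + 1 by ring] at key
  exact key

end Main

end ShellStep

end Literature.Combinatorics.Optimization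

end
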